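import Literature.MathematicalPhysics.QuantumFieldTheory.Balaban1983to89.B4CubeOpReindex
import Literature.MathematicalPhysics.QuantumFieldTheory.Balaban1983to89.B4Lemma22Invertible
import Literature.MathematicalPhysics.QuantumFieldTheory.Balaban1983to89.B4Prop31Holonomy
import Literature.MathematicalPhysics.QuantumFieldTheory.Balaban1983to89.B4TwoBox120

/-!
# `Balaban1983to89.B4SubBoxCarrier` — [Balaban1983RegularityDecay] §2 p. 575: the cubes `□_j ⊂ Ω` AS BOXES OF THE
# LEMMA-2.2 LINEAGE — for `Ω` a box (`B4Lemma22ReduceZero.Box d ℓ k M`, «for rectangular parallelepipeds …», p. 573)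
# every cube `□_j = Ω ∩ {2M-cube at Mj}` is a translated sub-box; the Neumann-cut cube data of the walk route
# (`B4Eq26Locality`/`B4Ineq110WalkRoute`), re-indexed along the translation, ARE the box operator `opA`/`greenA` of the
# sub-box at the translated field, so `G_k(□_j, Ã_j) = greenA` inverts the cut operator (hypothesis `hGj`) and carries
# the inputs `γ`, `β` (with `B4CubeOpReindex`)

statement-level skeleton of published theorems with citation tags; proofs where landed; nothing here is a claim about the Yang–Mills mass gap

CITATION HEADER.  T. Bałaban, *Regularity and decay of lattice Green's functions*, Commun. Math. Phys. **89** (1983)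
571–597, doi:10.1007/bf01214744 [Balaban1983RegularityDecay] (cell paper B4; held text
`paper:balaban1983-cmp89-regularity-decay`, journal page = PDF page + 570; pp. 572–573, 575–576).  Unit `lit-balaban-p17`
gen 4 (Phase-2 proof seat p17; HOME `run/shared/lean/pub/lit-balaban/`), SKELETON rows **B4.Def§2** (the cubes `□_j`),
**B4.Eq2.2**, **B4.Thm@573** (reserve item R9 «carrier bridge», file 2/4).  Imports `B4CubeOpReindex` (file 1/4: generic
padding / cut-operator block structure), `B4Lemma22Invertible` (`opA`/`greenA` on `Box d ℓ k M`), `B4Prop31Holonomy`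
(`stair_add`: the staircase contours translate) and `B4TwoBox120` (`blk_add_mul`: block indices translate).

WHAT IS PRINTED (verbatim, p. 575).  *«We have assumed that Ω^{(k)} is a sum of large blocks, i.e. blocks of the size M
on the unit lattice, thus Ω is a sum of the corresponding large blocks of the size M on η-lattice T_η. For each j ∈ Z^d,
let us define the set □_j = Ω ∩ {a sum of large blocks for which the point Mj is one of the vertices}. Let us observe
that if the point Mj is not a boundary point of Ω, then □_j is a cube of the size 2M and with center in Mj. For Mj lying
on the boundary the set □_j is a sum of several (≤ 2^d) large blocks.»*; p. 573: *«For some simple sets Ω, e.g. for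
rectangular parallelepipeds, the inequalities hold without any restrictions»*; p. 572 (1.1) (blocks
`y_μ ≤ x_μ < y_μ + 1`) and (1.3)–(1.6) (bond weights, block averages with contours `Γ^{(k)}_{y,x}`, the operator (1.6)).

WHAT THIS MODULE PROVES (all in full; `d + 1` lattice dimensions, mesh `n = L^k = (ℓ+1)^k`, big box
`Ω = Box d ℓ k Mb = Π_i[0, nMb_i)`, sub-box of sides `Ms` unit blocks with unit-lattice corner `o`, `o_i + Ms_i ≤ Mb_i`).
* §1 TRANSLATIONS of `ℤ^{d+1}`: nearest neighbours (`mem_nbrs_add_iff`), bond sums along embedded contours (`lsum_map`);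
  block indices and the lineage's STAIRCASE contours translate by the tree's `B4TwoBox120.blk_add_mul` and
  `B4Prop31Holonomy.stair_add` (imported, reused by name).
* §2 THE SUB-BOX EMBEDDING `subEmb : Box d ℓ k Ms ↪ Box d ℓ k Mb` (fine sites, shift `n·o`) and `subEmbY` (unit blocks,
  shift `o`), its image `inSub` (decidable), block compatibility (`blkWt_subEmb_ne_zero`, `inSub_iff_of_blkWt`).
* §3 DATA IDENTITIES along the embedding: `boxWt_subEmb`, `blkWt_subEmb`, `baseEmb_subEmbY`, `stairContour_subEmb`,
  `contourTrans_subEmb` — [B4]'s weights, blocks, base corners, staircase contours and transporters of the big box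
  restrict to those of the sub-box.
* (sequel `B4CubeGreenBox`: the cube data of the walk route on the box `Ω`, `hGj`, and the inputs `γ`, `β` as statements
  about `greenA` on `Box d ℓ k Ms`.)

HONEST SCOPE.  Boxes only (the print's «rectangular parallelepipeds» case; for a general union of big blocks `Ω` the
boundary cubes are not boxes and the print restricts to `dist(x, Ω^c) ≥ R₀`); pure lattice geometry, no analytic bound.
`def`s with bodies (`subEmb`, `subEmbY`, `inSub`), no `Prop` fact, no `sorry`; axioms standard.
-/

namespace Literature.MathematicalPhysics.QuantumFieldTheory.Balaban1983to89.B4SubBoxCarrier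

open Literature.MathematicalPhysics.QuantumFieldTheory.Balaban1983to89.B4Reflection242 (boxDom mem_boxDom nbrs mem_nbrs
  blk blk_mem_boxDom)
open Literature.MathematicalPhysics.QuantumFieldTheory.Balaban1983to89.B4GaugeCovariance
open Literature.MathematicalPhysics.QuantumFieldTheory.Balaban1983to89.B4Commutators25to211 (mulH opK)
open Literature.MathematicalPhysics.QuantumFieldTheory.Balaban1983to89.B4Lower18Regular (e1 stair lsum baseEmb
  stairContour transport_fieldLink blkWt_ne_zero)
open Literature.MathematicalPhysics.QuantumFieldTheory.Balaban1983to89.B4Lemma22ReduceZero (Box opA greenA)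
open Literature.MathematicalPhysics.QuantumFieldTheory.Balaban1983to89.B4Prop31Holonomy (stair_add)
open Literature.MathematicalPhysics.QuantumFieldTheory.Balaban1983to89.B4TwoBox120 (blk_add_mul)
open Literature.MathematicalPhysics.QuantumFieldTheory.Balaban1983to89.B4CubeOpReindex
open scoped Matrix
open scoped Matrix.Norms.Operator

noncomputable section

variable {d : ℕ}

/-! ## §1. Translations of `ℤ^{d+1}`: neighbours, bond sums along embedded contours -/

/-- nearest neighbours are translation invariant. [cite: Balaban1983RegularityDecay, (1.3) p.572 «bonds», dictionary] -/
theorem mem_nbrs_add_iff (x z t : Fin (d + 1) → ℤ) : z + t ∈ nbrs (x + t) ↔ z ∈ nbrs x := by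
  simp only [mem_nbrs]
  constructor
  · rintro ⟨i, h | h⟩
    · exact ⟨i, Or.inl (by rw [add_right_comm] at h; exact add_right_cancel h)⟩
    · exact ⟨i, Or.inr (by rw [sub_eq_add_neg, add_right_comm, ← sub_eq_add_neg] at h; exact add_right_cancel h)⟩
  · rintro ⟨i, h | h⟩
    · exact ⟨i, Or.inl (by rw [h, add_right_comm])⟩
    · exact ⟨i, Or.inr (by rw [h, sub_eq_add_neg, add_right_comm, ← sub_eq_add_neg])⟩

/-- bond sums along a translated contour. [cite: Balaban1983RegularityDecay, (1.4) p.572 «A(Γ) = Σ_{b⊂Γ} A_b», dictionary] -/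
theorem lsum_map {X X' : Type*} (B : X → X → ℝ) (e : X' → X) :
    ∀ (x : X') (l : List X'), lsum B (e x) (l.map e) = lsum (fun a b => B (e a) (e b)) x l
  | _, [] => rfl
  | x, y :: l => by rw [List.map_cons, lsum, lsum, lsum_map B e y l]

/-! ## §2. The sub-box embedding -/

section SubBox

variable (ℓ k : ℕ) (Mb Ms : Fin (d + 1) → ℕ) (o : Fin (d + 1) → ℕ)

/-- the fine sites of the sub-box are sites of the big box. [cite: Balaban1983RegularityDecay, §2 p.575 «□_j = Ω ∩ {…}»] -/
theorem shift_mem_Box (ho : ∀ i, o i + Ms i ≤ Mb i) (z : ↥(Box d ℓ k Ms)) :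
    (fun i => z.1 i + ((ℓ + 1) ^ k : ℕ) * (o i : ℤ)) ∈ Box d ℓ k Mb := by
  have hz := mem_boxDom.1 z.2
  rw [Box, mem_boxDom]
  intro i
  obtain ⟨h1, h2⟩ := hz i
  have hoi := ho i
  have hn0 : (0 : ℤ) ≤ ((ℓ + 1) ^ k : ℕ) := by positivity
  refine ⟨by positivity, ?_⟩
  push_cast at h2 ⊢
  have : (((ℓ + 1) ^ k : ℕ) : ℤ) * ((o i : ℤ) + Ms i) ≤ (((ℓ + 1) ^ k : ℕ) : ℤ) * (Mb i : ℤ) :=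
    mul_le_mul_of_nonneg_left (by exact_mod_cast hoi) hn0
  rw [mul_add] at this
  push_cast at this
  linarith

/-- **THE SUB-BOX EMBEDDING** of fine sites: `z ↦ z + n·o` (`n = L^k`, corner `o` in unit-lattice coordinates).
[cite: Balaban1983RegularityDecay, §2 p.575 «□_j = Ω ∩ {a sum of large blocks …}»] -/
def subEmb (ho : ∀ i, o i + Ms i ≤ Mb i) (z : ↥(Box d ℓ k Ms)) : ↥(Box d ℓ k Mb) :=
  ⟨fun i => z.1 i + ((ℓ + 1) ^ k : ℕ) * (o i : ℤ), shift_mem_Box ℓ k Mb Ms o ho z⟩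

/-- the unit blocks of the sub-box are unit blocks of the big box. [cite: Balaban1983RegularityDecay, (1.1) p.572] -/
theorem shift_mem_boxDom (ho : ∀ i, o i + Ms i ≤ Mb i) (y : ↥(boxDom Ms)) : (fun i => y.1 i + (o i : ℤ)) ∈ boxDom Mb := by
  have hy := mem_boxDom.1 y.2
  rw [mem_boxDom]
  intro i
  obtain ⟨h1, h2⟩ := hy i
  have hoi : ((o i : ℤ) + Ms i) ≤ Mb i := by exact_mod_cast ho i
  exact ⟨by positivity, by linarith⟩

/-- the embedding of unit blocks: `y ↦ y + o`. [cite: Balaban1983RegularityDecay, (1.1) p.572] -/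
def subEmbY (ho : ∀ i, o i + Ms i ≤ Mb i) (y : ↥(boxDom Ms)) : ↥(boxDom Mb) :=
  ⟨fun i => y.1 i + (o i : ℤ), shift_mem_boxDom Mb Ms o ho y⟩

/-- THE IMAGE: a fine site of the big box lies in the sub-box iff `n·o_i ≤ x_i < n·(o_i + Ms_i)` for every `i`.
[cite: Balaban1983RegularityDecay, §2 p.575] -/
def inSub (x : ↥(Box d ℓ k Mb)) : Prop :=
  ∀ i, (((ℓ + 1) ^ k : ℕ) : ℤ) * (o i : ℤ) ≤ x.1 i ∧ x.1 i < (((ℓ + 1) ^ k : ℕ) : ℤ) * ((o i : ℤ) + Ms i)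

/-- membership in the sub-box is decidable (the cut weights `1[z ∈ □ ↔ z′ ∈ □]·c` of the walk route need it).
[cite: Balaban1983RegularityDecay, §2 p.575, dictionary] -/
instance inSub.decidablePred : DecidablePred (inSub (d := d) ℓ k Mb Ms o) := fun x => by
  unfold inSub; infer_instance

/-- `subEmb` is injective. [cite: Balaban1983RegularityDecay, §2 p.575, dictionary] -/
theorem subEmb_injective (ho : ∀ i, o i + Ms i ≤ Mb i) : Function.Injective (subEmb ℓ k Mb Ms o ho) := by
  intro a b h
  apply Subtype.ext
  funext i
  have := congrArg (fun z : ↥(Box d ℓ k Mb) => z.1 i) h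
  simpa [subEmb] using this

/-- `subEmbY` is injective. [cite: Balaban1983RegularityDecay, (1.1) p.572, dictionary] -/
theorem subEmbY_injective (ho : ∀ i, o i + Ms i ≤ Mb i) : Function.Injective (subEmbY Mb Ms o ho) := by
  intro a b h
  apply Subtype.ext
  funext i
  have := congrArg (fun z : ↥(boxDom Mb) => z.1 i) h
  simpa [subEmbY] using this

/-- the image of `subEmb` is `inSub`. [cite: Balaban1983RegularityDecay, §2 p.575] -/
theorem inSub_iff (ho : ∀ i, o i + Ms i ≤ Mb i) (x : ↥(Box d ℓ k Mb)) : inSub ℓ k Mb Ms o x ↔ ∃ a, subEmb ℓ k Mb Ms o ho a = x := by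
  constructor
  · intro hx
    have hmem : (fun i => x.1 i - (((ℓ + 1) ^ k : ℕ) : ℤ) * (o i : ℤ)) ∈ Box d ℓ k Ms := by
      rw [Box, mem_boxDom]
      intro i
      obtain ⟨h1, h2⟩ := hx i
      refine ⟨by linarith, ?_⟩
      have h2' := h2
      rw [mul_add] at h2'
      push_cast at h1 h2' ⊢
      linarith
    refine ⟨⟨_, hmem⟩, Subtype.ext (funext fun i => ?_)⟩
    simp [subEmb]
  · rintro ⟨a, rfl⟩ i
    have ha := (mem_boxDom.1 a.2) i
    obtain ⟨h1, h2⟩ := ha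
    simp only [subEmb]
    push_cast at h2 ⊢
    constructor <;> nlinarith

/-- the block index of an embedded site is the embedded block index. [cite: Balaban1983RegularityDecay, (1.1) p.572] -/
theorem blk_subEmb (ho : ∀ i, o i + Ms i ≤ Mb i) (a : ↥(Box d ℓ k Ms)) :
    blk ((ℓ + 1) ^ k) (subEmb ℓ k Mb Ms o ho a).1 = fun i => blk ((ℓ + 1) ^ k) a.1 i + (o i : ℤ) := by
  have hn : 1 ≤ (ℓ + 1) ^ k := Nat.one_le_pow _ _ (Nat.succ_pos ℓ)
  have : (subEmb ℓ k Mb Ms o ho a).1 = a.1 + fun i => (((ℓ + 1) ^ k : ℕ) : ℤ) * (o i : ℤ) := by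
    funext i; simp [subEmb]
  rw [this, blk_add_mul hn]
  rfl

/-- a site of the big box in the same unit block as a sub-box site lies in the sub-box (the sub-box is a union of unit
blocks). [cite: Balaban1983RegularityDecay, (1.1) p.572, §2 p.575] -/
theorem inSub_of_blk_eq {x z : ↥(Box d ℓ k Mb)} (hxz : blk ((ℓ + 1) ^ k) x.1 = blk ((ℓ + 1) ^ k) z.1)
    (hx : inSub ℓ k Mb Ms o x) : inSub ℓ k Mb Ms o z := by
  have hn : 1 ≤ (ℓ + 1) ^ k := Nat.one_le_pow _ _ (Nat.succ_pos ℓ)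
  have hn0 : (0 : ℤ) < (((ℓ + 1) ^ k : ℕ) : ℤ) := by exact_mod_cast hn
  intro i
  obtain ⟨h1, h2⟩ := hx i
  have hb := congrFun hxz i
  simp only [blk] at hb
  -- `x_i` and `z_i` have the same quotient by `n`
  set n : ℤ := (((ℓ + 1) ^ k : ℕ) : ℤ) with hndef
  have hx1 := Int.mul_ediv_add_emod (x.1 i) n
  have hz1 := Int.mul_ediv_add_emod (z.1 i) n
  have hrx0 := Int.emod_nonneg (x.1 i) hn0.ne'
  have hrx1 := Int.emod_lt_of_pos (x.1 i) hn0
  have hrz0 := Int.emod_nonneg (z.1 i) hn0.ne'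
  have hrz1 := Int.emod_lt_of_pos (z.1 i) hn0
  -- quotient bounds: `o_i ≤ q < o_i + Ms_i`
  have hq1 : (o i : ℤ) ≤ x.1 i / n := by
    by_contra hlt
    rw [not_le] at hlt
    have : x.1 i / n + 1 ≤ o i := by omega
    nlinarith
  have hq2 : x.1 i / n < (o i : ℤ) + Ms i := by
    by_contra hle
    rw [not_lt] at hle
    nlinarith
  rw [hb] at hq1 hq2
  constructor <;> nlinarith

/-- a non-zero block weight `q(y, subEmb b)` forces `y` to be a block of the sub-box. [cite: Balaban1983RegularityDecay, (1.4) p.572] -/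
theorem blkWt_subEmb_ne_zero (ho : ∀ i, o i + Ms i ≤ Mb i) {y : ↥(boxDom Mb)} {b : ↥(Box d ℓ k Ms)}
    (h : blkWt ((ℓ + 1) ^ k) Mb (fun i => (ℓ + 1) ^ k * Mb i) y (subEmb ℓ k Mb Ms o ho b) ≠ 0) :
    ∃ y', subEmbY Mb Ms o ho y' = y := by
  have hn : 1 ≤ (ℓ + 1) ^ k := Nat.one_le_pow _ _ (Nat.succ_pos ℓ)
  have hb := blkWt_ne_zero h
  rw [blk_subEmb] at hb
  have hmem : blk ((ℓ + 1) ^ k) b.1 ∈ boxDom Ms := blk_mem_boxDom hn b.2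
  refine ⟨⟨blk ((ℓ + 1) ^ k) b.1, hmem⟩, Subtype.ext ?_⟩
  rw [← hb]
  rfl

/-- blocks do not straddle the sub-box: two sites with non-zero weight in the same block are both in or both out.
[cite: Balaban1983RegularityDecay, (1.1) p.572, §2 p.575] -/
theorem inSub_iff_of_blkWt {y : ↥(boxDom Mb)} {z z' : ↥(Box d ℓ k Mb)}
    (hz : blkWt ((ℓ + 1) ^ k) Mb (fun i => (ℓ + 1) ^ k * Mb i) y z ≠ 0)
    (hz' : blkWt ((ℓ + 1) ^ k) Mb (fun i => (ℓ + 1) ^ k * Mb i) y z' ≠ 0) :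
    inSub ℓ k Mb Ms o z ↔ inSub ℓ k Mb Ms o z' := by
  have h1 := blkWt_ne_zero hz
  have h2 := blkWt_ne_zero hz'
  have h12 : blk ((ℓ + 1) ^ k) z.1 = blk ((ℓ + 1) ^ k) z'.1 := by rw [h1, h2]
  exact ⟨inSub_of_blk_eq ℓ k Mb Ms o h12, inSub_of_blk_eq ℓ k Mb Ms o h12.symm⟩

/-! ## §3. Data identities along the embedding -/

/-- **BOND WEIGHTS RESTRICT**: `c(subEmb a, subEmb b) = c_□(a, b)`. [cite: Balaban1983RegularityDecay, (1.3) p.572] -/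
theorem boxWt_subEmb (ho : ∀ i, o i + Ms i ≤ Mb i) (a b : ↥(Box d ℓ k Ms)) :
    boxWt ((ℓ + 1) ^ k) (fun i => (ℓ + 1) ^ k * Mb i) (subEmb ℓ k Mb Ms o ho a) (subEmb ℓ k Mb Ms o ho b)
      = boxWt ((ℓ + 1) ^ k) (fun i => (ℓ + 1) ^ k * Ms i) a b := by
  unfold boxWt
  have : ((subEmb ℓ k Mb Ms o ho b).1 ∈ nbrs (subEmb ℓ k Mb Ms o ho a).1) ↔ (b.1 ∈ nbrs a.1) := by
    have ha : (subEmb ℓ k Mb Ms o ho a).1 = a.1 + fun i => (((ℓ + 1) ^ k : ℕ) : ℤ) * (o i : ℤ) := by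
      funext i; simp [subEmb]
    have hb : (subEmb ℓ k Mb Ms o ho b).1 = b.1 + fun i => (((ℓ + 1) ^ k : ℕ) : ℤ) * (o i : ℤ) := by
      funext i; simp [subEmb]
    rw [ha, hb, mem_nbrs_add_iff]
  simp only [this]

/-- **BLOCK WEIGHTS RESTRICT**: `q(subEmbY y′, subEmb b) = q_□(y′, b)`. [cite: Balaban1983RegularityDecay, (1.4) p.572] -/
theorem blkWt_subEmb (ho : ∀ i, o i + Ms i ≤ Mb i) (y' : ↥(boxDom Ms)) (b : ↥(Box d ℓ k Ms)) :
    blkWt ((ℓ + 1) ^ k) Mb (fun i => (ℓ + 1) ^ k * Mb i) (subEmbY Mb Ms o ho y') (subEmb ℓ k Mb Ms o ho b)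
      = blkWt ((ℓ + 1) ^ k) Ms (fun i => (ℓ + 1) ^ k * Ms i) y' b := by
  unfold blkWt
  rw [blk_subEmb]
  have : ((fun i => blk ((ℓ + 1) ^ k) b.1 i + (o i : ℤ)) = (subEmbY Mb Ms o ho y').1) ↔
      (blk ((ℓ + 1) ^ k) b.1 = y'.1) := by
    constructor
    · intro h; funext i; have := congrFun h i; simp [subEmbY] at this; exact this
    · intro h; funext i; simp [subEmbY, ← h]
  simp only [this]

/-- **BASE CORNERS RESTRICT**: `n·(y′ + o) = subEmb(n·y′)`. [cite: Balaban1983RegularityDecay, (1.4) p.572 «Γ^{(k)}_{y,x} … initial point y»] -/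
theorem baseEmb_subEmbY (ho : ∀ i, o i + Ms i ≤ Mb i) (hn : 1 ≤ (ℓ + 1) ^ k) (y' : ↥(boxDom Ms)) :
    baseEmb hn Mb (subEmbY Mb Ms o ho y') = subEmb ℓ k Mb Ms o ho (baseEmb hn Ms y') := by
  apply Subtype.ext
  funext i
  simp [baseEmb, subEmb, subEmbY]
  ring

/-- the underlying lattice points of a contour of box points. [folklore] -/
private theorem map_val_pmap_mk {X : Type*} {P : X → Prop} :
    ∀ (l : List X) (H : ∀ z ∈ l, P z), (l.pmap Subtype.mk H).map Subtype.val = l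
  | [], _ => rfl
  | a :: l, H => by
      rw [List.pmap, List.map_cons, map_val_pmap_mk l]

/-- the underlying lattice points of [B4]'s staircase contour `Γ_{y,x}`: the staircase from the base corner `n·y` when
`x ∈ B(y)`, nothing otherwise. [cite: Balaban1983RegularityDecay, (1.4) p.572 «Γ^{(k)}_{y,x}»] -/
theorem map_val_stairContour {n : ℕ} (hn : 1 ≤ n) (M : Fin (d + 1) → ℕ) (y : ↥(boxDom M))
    (x : ↥(boxDom fun i => n * M i)) :
    (stairContour hn M y x).map Subtype.val
      = if blk n x.1 = y.1 then stair (fun i => (n : ℤ) * y.1 i) x.1 else [] := by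
  unfold stairContour
  split_ifs with h
  · exact map_val_pmap_mk _ _
  · rfl

/-- **STAIRCASE CONTOURS RESTRICT**: `Γ_{subEmbY y′, subEmb b} = subEmb ∘ Γ_{y′, b}`.
[cite: Balaban1983RegularityDecay, (1.4) p.572 «Γ^{(k)}_{y,x}»] -/
theorem stairContour_subEmb (ho : ∀ i, o i + Ms i ≤ Mb i) (hn : 1 ≤ (ℓ + 1) ^ k) (y' : ↥(boxDom Ms))
    (b : ↥(Box d ℓ k Ms)) :
    stairContour hn Mb (subEmbY Mb Ms o ho y') (subEmb ℓ k Mb Ms o ho b)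
      = (stairContour hn Ms y' b).map (subEmb ℓ k Mb Ms o ho) := by
  apply List.map_injective_iff.2 Subtype.val_injective
  have hcomp : (Subtype.val ∘ subEmb ℓ k Mb Ms o ho)
      = (fun z : Fin (d + 1) → ℤ => z + fun i => (((ℓ + 1) ^ k : ℕ) : ℤ) * (o i : ℤ)) ∘ Subtype.val := by
    funext z
    funext i
    simp [subEmb]
  rw [List.map_map, hcomp, ← List.map_map, map_val_stairContour, map_val_stairContour]
  by_cases hb : blk ((ℓ + 1) ^ k) b.1 = y'.1
  · have hb' : blk ((ℓ + 1) ^ k) (subEmb ℓ k Mb Ms o ho b).1 = (subEmbY Mb Ms o ho y').1 := by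
      rw [blk_subEmb, hb]; rfl
    rw [if_pos hb', if_pos hb, ← stair_add]
    congr 1
    funext i
    simp [subEmbY, mul_add]
  · have hb' : ¬ blk ((ℓ + 1) ^ k) (subEmb ℓ k Mb Ms o ho b).1 = (subEmbY Mb Ms o ho y').1 := by
      intro h
      apply hb
      rw [blk_subEmb] at h
      funext i
      have := congrFun h i
      simp [subEmbY] at this
      exact this
    rw [if_neg hb', if_neg hb]
    rfl

/-- **TRANSPORTERS RESTRICT**: `U(Ã(Γ_{subEmbY y′, subEmb b})) = U((Ã∘subEmb)(Γ_{y′,b}))` for [B4]'s abelian links.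
[cite: Balaban1983RegularityDecay, (1.4) p.572 «U(A(Γ^{(k)}_{y,x}))»] -/
theorem contourTrans_subEmb {ι : Type} [Fintype ι] [DecidableEq ι] (F : OrthFlow ι) (κ : ℝ) (ho : ∀ i, o i + Ms i ≤ Mb i)
    (hn : 1 ≤ (ℓ + 1) ^ k) (A : ↥(Box d ℓ k Mb) → ↥(Box d ℓ k Mb) → ℝ) (y' : ↥(boxDom Ms)) (b : ↥(Box d ℓ k Ms)) :
    contourTrans (fieldLink F κ A) (baseEmb hn Mb) (stairContour hn Mb) (subEmbY Mb Ms o ho y')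
        (subEmb ℓ k Mb Ms o ho b)
      = contourTrans (fieldLink F κ fun a b => A (subEmb ℓ k Mb Ms o ho a) (subEmb ℓ k Mb Ms o ho b))
          (baseEmb hn Ms) (stairContour hn Ms) y' b := by
  unfold contourTrans
  rw [transport_fieldLink, transport_fieldLink, stairContour_subEmb, baseEmb_subEmbY, lsum_map]

end SubBox

end

end Literature.MathematicalPhysics.QuantumFieldTheory.Balaban1983to89.B4SubBoxCarrier
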